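import Summits.QuantumFields.BalabanUV.Beta.FP.TowerK2bDoorReadoutPeriodised
import Summits.QuantumFields.BalabanUV.Beta.FP.TowerDoorUniformDataColumn
import Summits.QuantumFields.BalabanUV.Beta.FP.TorusWJunctionOfNLeg

/-!
# `BalabanUV.Beta.FP.TowerDoorUniformDataTorus` — binder row D1, the row's ONE file, LEMMA U (J-NOTE-20 §6–§7): **THE TORUS ONE-SHOT SYSTEM's RESPONSE TO UNIFORM DATA IS THE FACE FIELD,
# AT THE END WRAPPER's LEG LETTERS** — under v9∕v10's displayed N leg `hLN` (the one-shot right inverse's field–multiplier block is the masked periodised chart) and torus rule `hEAN`,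
# the SUM over the torus sources of direction `μ` of the one-shot column `XN (inl b) (inr (inl (r, μ)))` unfolds to the LATTICE source sum `Σ'_z A b̃ (L•z) (inl b.2) (inr μ)` (box × period lattice ≃
# lattice; PART 47's unwrapping), hence — at the record's chart `σ·AN·σ` — to `sn⁻¹ · L^{−(d+1)}·[b.2 = μ]·[b̃_μ % L = L − 1]` by PART 51's U1
# (β-function cell `pub-balaban`, BINDER-OWNERS row D1 ∕ (C1) OWNER «beta-an2» gen 76, PART 52; the torus-side junction for U2 = road g54's (P-b) `N·(face field) = 0`)

WHY (located; road FP g53 (D) `TorusNestedGaugeReadout` p681260: `(N·W₀)·θ_v = −N·(XN₁₂·(v,0))`; J-NOTE-20 §7: LEMMA U ⟸ `N·(Σ_{sources} XN₁₂ e_(r,μ)) = 0`; road g54 (P-b) (A) `TorusNestedReadoutLocality`: `N` reads only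
bonds INSIDE the slot's big block).  This file supplies the middle identity: what `Σ_r XN₁₂ e_(r,μ)` IS — the periodised face field — so that (P-b)'s support theorem kills it (a face-crossing bond is inside NO block).
§1 the box × period-lattice unfolding of a lattice sum (`siteUnfold`, `tsum_eq_sum_pbox_tsum_translate`); §2 for any kernel `A` whose sublattice columns are summable and any torus `T = L•M′`:
`Σ_{r : pbox M′} perF T A (x, inl κ) (wrapPt T (L•r), inr μ) = Σ'_z A x̃ (L•z) (inl κ) (inr μ)` (PART 47 `wrap_eq_translate_neg_quo` ∕ `translate_smul_eq_smul_translate`, re-indexing, §1); §3 at the leg letters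
(`TorusWJunctionOfNLeg.leg12_of_hLN` + `mask_apply_eq_of_hEA`): `Σ_r XN (inl b) (inr (inl (r, μ))) = Σ'_z A b̃ (L•z) (inl b.2) (inr μ)`; §4 at the record's chart `scaleK σ σ (AN ρc (n+1))`, `σ = Sum.elim 1 (sn⁻¹)`:
summability from `decays_AN` (lit `summable_translate_of_decays`), the constant `sn⁻¹` out, PART 51 `tsum_AN_inl_inr_sources_eq` in: **`sum_XN_sources_eq_face`**.

WHAT ([folklore] re-indexing ∕ `tsum` bookkeeping BY NAME; no `def` beyond §1's local `Equiv` (a `def` of an equivalence, data not Prop — see below: AVOIDED, the equivalence is built inline), nothing cited, 0 sorry).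
WHAT THIS IS NOT: not U2 (road g54 (P-b)), not LEMMA U (`hΘ`), not STUB P (P-c); the door NOT defined; every leg letter (`hLN hEAN hfN`) a DISPLAYED hypothesis as in v9∕v10; nothing of Bałaban's asserted, valued or discharged;
0 estimates; 0∕4 row-D1 binders (hW, hR, D1Tel, D1Rep); v10 NOT filed; v9 p617999 stands; NOT (C1), NOT (T-ID), NOT D1, NEVER «G-an2-4 closed», NOT BetaPertH, NOT continuum, NOT Clay.

HONEST DEPENDENCY (page 1, mandatory): continuum YM on T⁴ ⇐ BetaPertH ∧ nine spine estimates (0/9 proved); BetaPertH ⇐ (D1) ∧ (D4) ∧ CAP+tail;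
G-an2-4 gates asym, D1 and NE2/3/4.  HONEST FRAMING (cell contract, verbatim): «discharging `BetaPertH` makes Bałaban's UV stability UNCONDITIONAL —
a real constructive-QFT result; it is NOT the continuum limit and NOT the Clay problem.»  ABSOLUTE RULE (cell charter, verbatim): «No internally-minted
statement may enter as a cited fact. Every hypothesis is either kernel-proved in this package or a verbatim quotation of a PUBLISHED theorem with page
reference. The manuscript(s) under audit are NOT citable for their own disputed steps — they are the thing under adjudication; programme-internal
(2001/route/tribunal) claims are never citable.»  Row D1 ∕ (C1) OWNER «beta-an2» gen 76, 2026-08-29.  No existing file touched.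
-/

noncomputable section

open Finset Matrix
open scoped BigOperators
open Literature.MathematicalPhysics.QuantumFieldTheory
open Literature.MathematicalPhysics.QuantumFieldTheory.Balaban1983to89
open Literature.MathematicalPhysics.QuantumFieldTheory.Balaban1983to89.Beta
open B4TorusKernel.MultiPeriod (translate translate_injective)
open B4Reflection242 (translate_translate)
open B6Lemma24Torus (pbox wrap)
open AffineAveraging (Site)
open ExpKernelCalculus (MKer Decays)
open OneStepResolventKernel (Fib)
open HessKerRate (scaleK scaleK_apply)
open Summit.QuantumFields.BalabanUV.Beta.AxialDressingRooted (axEc)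
open Summit.QuantumFields.BalabanUV.Beta.CompositeOneShotJetData (Roots AN)
open Summit.QuantumFields.BalabanUV.Beta.NVertexSectors (decays_AN)
open Summit.QuantumFields.BalabanUV.Beta.FP.KernelPeriodisationFib (Idx perF perZ perF_apply perZ_apply summable_translate_of_decays)
open Summit.QuantumFields.BalabanUV.Beta.FP.TorusGaugeCovariancePairing (wrapPt wrapPt_coe wrapPt_of_mem)
open Summit.QuantumFields.BalabanUV.Beta.GAN24.KernelPeriodisation (quo translate_wrap_quo wrap_translate quo_translate)
open Summit.QuantumFields.BalabanUV.Beta.FP.TowerK2bDoorReadoutPeriodised (wrap_eq_translate_neg_quo translate_smul_eq_smul_translate)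
open Summit.QuantumFields.BalabanUV.Beta.FP.TowerDoorUniformDataColumn (tsum_AN_inl_inr_sources_eq)
open Summit.QuantumFields.BalabanUV.Beta.FP.TorusWJunctionOfNLeg (leg12_of_hLN mask_apply_eq_of_hEA)

namespace Summit.QuantumFields.BalabanUV.Beta.FP.TowerDoorUniformDataTorus

/-! ## §1 Unfolding a lattice sum along the box and the period lattice -/

section Unfold

variable (M : Fin (3 + 1) → ℕ) [∀ i, NeZero (M i)]

/-- [folklore] **`Σ'_z f z = Σ_{r ∈ box} Σ'_m f (r̃ + M∘m)`** for a summable `f` (the equivalence `(r, m) ↦ translate M r̃ m` with inverse `z ↦ (wrapPt M z, quo M z)`, built inline;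
`Summable.tsum_prod`, `tsum_fintype`). -/
theorem tsum_eq_sum_pbox_tsum_translate {f : Site (3 + 1) → ℝ} (hf : Summable f) :
    ∑' z : Site (3 + 1), f z = ∑ r : ↥(pbox M), ∑' m : Site (3 + 1), f (translate M (r : Site (3 + 1)) m) := by
  let e : ↥(pbox M) × Site (3 + 1) ≃ Site (3 + 1) :=
    { toFun := fun x => translate M (x.1 : Site (3 + 1)) x.2
      invFun := fun z => (wrapPt M z, quo M z)
      left_inv := fun x => by
        obtain ⟨r, m⟩ := x
        simp only
        rw [Prod.mk.injEq]
        exact ⟨Subtype.ext (by rw [wrapPt_coe, wrap_translate M r.2]), quo_translate M r.2 m⟩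
      right_inv := fun z => by
        simp only [wrapPt_coe]
        exact translate_wrap_quo M z }
  have hs : Summable (fun x : ↥(pbox M) × Site (3 + 1) => f (e x)) := e.summable_iff.2 hf
  rw [← e.tsum_eq f, hs.tsum_prod, tsum_fintype]
  rfl

end Unfold

/-! ## §2 The periodised field–multiplier columns summed over the torus sources unfold to the lattice source sum -/

section Columns

variable {Lc : ℕ} [NeZero Lc]

/-- [folklore] **`sum_perF_inl_inr_sources_eq_tsum`**: for any kernel `A` whose sublattice column `z ↦ A x (L•z) (inl κ) (inr μ)` is summable and any torus `T` with `T i = L · M′ i`,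
`Σ_{r : pbox M′} perF T A (x, inl κ) (wrapPt T (L•r̃), inr μ) = Σ'_z A x̃ (L•z) (inl κ) (inr μ)` (unwrap the source representative, move to the coarse translate, re-index, §1). -/
theorem sum_perF_inl_inr_sources_eq_tsum (L : ℕ) (T M' : Fin (3 + 1) → ℕ) [∀ i, NeZero (T i)] [∀ i, NeZero (M' i)] (hT : ∀ i, T i = L * M' i)
    (A : MKer (3 + 1) (Fib 3)) (x : ↥(pbox T)) (κ μ : Fin (3 + 1))
    (hs : Summable (fun z : Site (3 + 1) => A (x : Site (3 + 1)) (((L : ℕ) : ℤ) • z) (Sum.inl κ) (Sum.inr μ))) :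
    ∑ r : ↥(pbox M'), perF T A (x, Sum.inl κ) (wrapPt T (((L : ℕ) : ℤ) • (r : Site (3 + 1))), Sum.inr μ)
      = ∑' z : Site (3 + 1), A (x : Site (3 + 1)) (((L : ℕ) : ℤ) • z) (Sum.inl κ) (Sum.inr μ) := by
  rw [tsum_eq_sum_pbox_tsum_translate M' hs]
  refine Finset.sum_congr rfl fun r _ => ?_
  rw [perF_apply, perZ_apply]
  simp only [wrapPt_coe]
  set q : Site (3 + 1) := quo T (((L : ℕ) : ℤ) • (r : Site (3 + 1))) with hq
  have e : ∀ m : Site (3 + 1), A (x : Site (3 + 1)) (translate T (wrap T (((L : ℕ) : ℤ) • (r : Site (3 + 1)))) m) (Sum.inl κ) (Sum.inr μ)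
      = A (x : Site (3 + 1)) (((L : ℕ) : ℤ) • translate M' (r : Site (3 + 1)) (-q + m)) (Sum.inl κ) (Sum.inr μ) := by
    intro m
    rw [wrap_eq_translate_neg_quo, ← hq, translate_translate, translate_smul_eq_smul_translate L T M' hT]
  simp_rw [e]
  exact (Equiv.addLeft (-q)).tsum_eq (fun m : Site (3 + 1) => A (x : Site (3 + 1)) (((L : ℕ) : ℤ) • translate M' (r : Site (3 + 1)) m) (Sum.inl κ) (Sum.inr μ))

end Columns

/-! ## §3 At the END wrapper's leg letters: the one-shot column summed over the torus sources -/

section Leg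

variable (T : Fin (3 + 1) → ℕ) [∀ i, NeZero (T i)] {κs ρs : Type*}

/-- [folklore] **`sum_XN_sources_eq_tsum` — THE TORUS ONE-SHOT SYSTEM's RESPONSE TO UNIFORM DATA, AT THE LEG LETTERS**: under the wrapper's N leg `hLN` (generic chart `A`, mask `axEc ρN LNc`,
slot map `fN`), torus rule `hEAN`, and the slot pin `hfN : fN a = (wrapPt T (L • (slot a).1), inr (slot a).2)` for a slot parametrisation `slot : κs ≃ pbox M′ × Fin 4` of the torus `T = L•M′`:
for every finest bond `b` and direction `μ`, `Σ_{r : pbox M′} XN (inl b) (inr (inl (slot⁻¹ (r, μ)))) = Σ'_z A b̃ (L•z) (inl b.2) (inr μ)` (summable sublattice columns displayed). -/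
theorem sum_XN_sources_eq_tsum (L : ℕ) (M' : Fin (3 + 1) → ℕ) [∀ i, NeZero (M' i)] (hT : ∀ i, T i = L * M' i)
    (ρN : Site (3 + 1)) (LNc : ℕ) (A : MKer (3 + 1) (Fib 3)) (fN : κs → Idx T (Fib 3))
    (slot : κs ≃ ↥(pbox M') × Fin (3 + 1))
    (hfN : ∀ a : κs, fN a = (wrapPt T (((L : ℕ) : ℤ) • ((slot a).1 : Site (3 + 1))), Sum.inr (slot a).2))
    {XN : Matrix ((↥(pbox T) × Fin (3 + 1)) ⊕ (κs ⊕ ρs)) ((↥(pbox T) × Fin (3 + 1)) ⊕ (κs ⊕ ρs)) ℝ}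
    (hEAN : perF T (axEc ρN LNc) * perF T A = perF T A)
    (hLN : XN.submatrix (Sum.map id Sum.inl) (Sum.map id Sum.inl) = fromBlocks
      (Matrix.of fun (b b' : (↥(pbox T) × Fin (3 + 1))) =>
        axEc ρN LNc (b.1 : Site (3 + 1)) (b.1 : Site (3 + 1)) (Sum.inl b.2) (Sum.inl b.2)
          * (axEc ρN LNc (b'.1 : Site (3 + 1)) (b'.1 : Site (3 + 1)) (Sum.inl b'.2) (Sum.inl b'.2) * perF T A (b.1, Sum.inl b.2) (b'.1, Sum.inl b'.2)))
      (Matrix.of fun (b : (↥(pbox T) × Fin (3 + 1))) (a : κs) =>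
        axEc ρN LNc (b.1 : Site (3 + 1)) (b.1 : Site (3 + 1)) (Sum.inl b.2) (Sum.inl b.2) * perF T A (b.1, Sum.inl b.2) (fN a))
      (-Matrix.of fun (a : κs) (b : (↥(pbox T) × Fin (3 + 1))) =>
        axEc ρN LNc (b.1 : Site (3 + 1)) (b.1 : Site (3 + 1)) (Sum.inl b.2) (Sum.inl b.2) * perF T A (fN a) (b.1, Sum.inl b.2))
      (-((perF T A).submatrix fN fN)))
    (b : ↥(pbox T) × Fin (3 + 1)) (μ : Fin (3 + 1))
    (hs : Summable (fun z : Site (3 + 1) => A (b.1 : Site (3 + 1)) (((L : ℕ) : ℤ) • z) (Sum.inl b.2) (Sum.inr μ))) :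
    ∑ r : ↥(pbox M'), XN (Sum.inl b) (Sum.inr (Sum.inl (slot.symm (r, μ))))
      = ∑' z : Site (3 + 1), A (b.1 : Site (3 + 1)) (((L : ℕ) : ℤ) • z) (Sum.inl b.2) (Sum.inr μ) := by
  have e : ∀ r : ↥(pbox M'), XN (Sum.inl b) (Sum.inr (Sum.inl (slot.symm (r, μ))))
      = perF T A (b.1, Sum.inl b.2) (wrapPt T (((L : ℕ) : ℤ) • (r : Site (3 + 1))), Sum.inr μ) := by
    intro r
    rw [leg12_of_hLN T ρN LNc A fN hLN b (slot.symm (r, μ)), mask_apply_eq_of_hEA T ρN LNc A hEAN (b.1, Sum.inl b.2) (fN (slot.symm (r, μ))),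
      hfN, Equiv.apply_symm_apply]
  simp_rw [e]
  exact sum_perF_inl_inr_sources_eq_tsum L T M' hT A b.1 b.2 μ hs

end Leg

/-! ## §4 At the record's chart `σ·AN·σ`: the face field -/

section Record

variable {Lc : ℕ} [NeZero Lc] (R : Roots Lc) (j : ℕ)

/-- [folklore] the sublattice field–multiplier columns of the `σ`-conjugated chart are summable (`decays_AN`, lit `summable_translate_of_decays`, a constant out). -/
theorem summable_scaleK_AN_inl_inr_sources (u v : Fib 3 → ℝ) (x : Site (3 + 1)) (κ μ : Fin (3 + 1)) :
    Summable (fun z : Site (3 + 1) => scaleK u v (AN R j) x (((Lc ^ (j + 1) : ℕ) : ℤ) • z) (Sum.inl κ) (Sum.inr μ)) := by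
  obtain ⟨δ, C, hδ, hC, hA⟩ := decays_AN R j
  have h := summable_translate_of_decays hA hC hδ (Q := fun _ : Fin (3 + 1) => Lc ^ (j + 1))
    (fun _ => Nat.one_le_iff_ne_zero.mpr (NeZero.ne (Lc ^ (j + 1)))) x 0 (Sum.inl κ) (Sum.inr μ)
  have e : (fun m : Site (3 + 1) => AN R j x (translate (fun _ : Fin (3 + 1) => Lc ^ (j + 1)) 0 m) (Sum.inl κ) (Sum.inr μ))
      = fun z : Site (3 + 1) => AN R j x (((Lc ^ (j + 1) : ℕ) : ℤ) • z) (Sum.inl κ) (Sum.inr μ) := by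
    funext m; congr 1; funext i
    simp only [B4TorusKernel.MultiPeriod.translate_apply, Pi.zero_apply, zero_add, Pi.smul_apply, smul_eq_mul]
  rw [e] at h
  simp only [scaleK_apply]
  exact (h.mul_left (u (Sum.inl κ))).mul_right (v (Sum.inr μ))

/-- [folklore] **`tsum_scaleK_AN_inl_inr_sources_eq` — THE `σ`-CONJUGATED CHART's RESPONSE TO UNIFORM DATA**: with `σ = Sum.elim u⁽ᶠ⁾ u⁽ᵐ⁾` acting by constants per leg type,
`Σ'_z (σ·AN·σ) x (L•z) (inl κ) (inr μ) = u⁽ᶠ⁾ κ · u⁽ᵐ⁾ μ · (if x_κ % L = L − 1 then L·δ_{κμ}·L^{−(d+2)} else 0)` (PART 51 `tsum_AN_inl_inr_sources_eq`, constants out). -/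
theorem tsum_scaleK_AN_inl_inr_sources_eq (u v : Fib 3 → ℝ) (x : Site (3 + 1)) (κ μ : Fin (3 + 1)) :
    (∑' z : Site (3 + 1), scaleK u v (AN R j) x (((Lc ^ (j + 1) : ℕ) : ℤ) • z) (Sum.inl κ) (Sum.inr μ))
      = u (Sum.inl κ) * v (Sum.inr μ) *
        (if x κ % ((Lc ^ (j + 1) : ℕ) : ℤ) = ((Lc ^ (j + 1) : ℕ) : ℤ) - 1
          then ((Lc ^ (j + 1) : ℕ) : ℝ) * (if κ = μ then ((((Lc ^ (j + 1) : ℕ) : ℝ) ^ (3 + 1 + 1))⁻¹) else 0) else 0) := by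
  simp only [scaleK_apply]
  have e : (fun z : Site (3 + 1) => u (Sum.inl κ) * AN R j x (((Lc ^ (j + 1) : ℕ) : ℤ) • z) (Sum.inl κ) (Sum.inr μ) * v (Sum.inr μ))
      = fun z => (u (Sum.inl κ) * v (Sum.inr μ)) * AN R j x (((Lc ^ (j + 1) : ℕ) : ℤ) • z) (Sum.inl κ) (Sum.inr μ) := by
    funext z; ring
  rw [e, tsum_mul_left, tsum_AN_inl_inr_sources_eq R j x κ μ]

/-- [folklore] **`sum_XN_sources_eq_face` — U1 ON THE TORUS, AT THE WRAPPER's LETTERS**: under `hLN ∕ hEAN ∕ hfN` with the record's chart `scaleK σ σ (AN R j)` on the torus `T = Lc^(j+1) • M′`,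
the one-shot column summed over the torus sources of direction `μ` is the FACE FIELD read at the bond's representative:
`Σ_r XN (inl b) (inr (inl (slot⁻¹ (r, μ)))) = σ(inl b.2)·σ(inr μ)·(if b̃_{b.2} % L = L − 1 then L·δ_{b.2 μ}·L^{−(d+2)} else 0)`. -/
theorem sum_XN_sources_eq_face (T M' : Fin (3 + 1) → ℕ) [∀ i, NeZero (T i)] [∀ i, NeZero (M' i)] (hT : ∀ i, T i = Lc ^ (j + 1) * M' i)
    {κs ρs : Type*} (σ : Fib 3 → ℝ) (ρN : Site (3 + 1)) (LNc : ℕ) (fN : κs → Idx T (Fib 3))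
    (slot : κs ≃ ↥(pbox M') × Fin (3 + 1))
    (hfN : ∀ a : κs, fN a = (wrapPt T (((Lc ^ (j + 1) : ℕ) : ℤ) • ((slot a).1 : Site (3 + 1))), Sum.inr (slot a).2))
    {XN : Matrix ((↥(pbox T) × Fin (3 + 1)) ⊕ (κs ⊕ ρs)) ((↥(pbox T) × Fin (3 + 1)) ⊕ (κs ⊕ ρs)) ℝ}
    (hEAN : perF T (axEc ρN LNc) * perF T (scaleK σ σ (AN R j)) = perF T (scaleK σ σ (AN R j)))
    (hLN : XN.submatrix (Sum.map id Sum.inl) (Sum.map id Sum.inl) = fromBlocks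
      (Matrix.of fun (b b' : (↥(pbox T) × Fin (3 + 1))) =>
        axEc ρN LNc (b.1 : Site (3 + 1)) (b.1 : Site (3 + 1)) (Sum.inl b.2) (Sum.inl b.2)
          * (axEc ρN LNc (b'.1 : Site (3 + 1)) (b'.1 : Site (3 + 1)) (Sum.inl b'.2) (Sum.inl b'.2)
            * perF T (scaleK σ σ (AN R j)) (b.1, Sum.inl b.2) (b'.1, Sum.inl b'.2)))
      (Matrix.of fun (b : (↥(pbox T) × Fin (3 + 1))) (a : κs) =>
        axEc ρN LNc (b.1 : Site (3 + 1)) (b.1 : Site (3 + 1)) (Sum.inl b.2) (Sum.inl b.2) * perF T (scaleK σ σ (AN R j)) (b.1, Sum.inl b.2) (fN a))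
      (-Matrix.of fun (a : κs) (b : (↥(pbox T) × Fin (3 + 1))) =>
        axEc ρN LNc (b.1 : Site (3 + 1)) (b.1 : Site (3 + 1)) (Sum.inl b.2) (Sum.inl b.2) * perF T (scaleK σ σ (AN R j)) (fN a) (b.1, Sum.inl b.2))
      (-((perF T (scaleK σ σ (AN R j))).submatrix fN fN)))
    (b : ↥(pbox T) × Fin (3 + 1)) (μ : Fin (3 + 1)) :
    ∑ r : ↥(pbox M'), XN (Sum.inl b) (Sum.inr (Sum.inl (slot.symm (r, μ))))
      = σ (Sum.inl b.2) * σ (Sum.inr μ) *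
        (if (b.1 : Site (3 + 1)) b.2 % ((Lc ^ (j + 1) : ℕ) : ℤ) = ((Lc ^ (j + 1) : ℕ) : ℤ) - 1
          then ((Lc ^ (j + 1) : ℕ) : ℝ) * (if b.2 = μ then ((((Lc ^ (j + 1) : ℕ) : ℝ) ^ (3 + 1 + 1))⁻¹) else 0) else 0) := by
  rw [sum_XN_sources_eq_tsum T (Lc ^ (j + 1)) M' hT ρN LNc (scaleK σ σ (AN R j)) fN slot hfN hEAN hLN b μ
    (summable_scaleK_AN_inl_inr_sources R j σ σ (b.1 : Site (3 + 1)) b.2 μ)]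
  exact tsum_scaleK_AN_inl_inr_sources_eq R j σ σ (b.1 : Site (3 + 1)) b.2 μ

end Record

end Summit.QuantumFields.BalabanUV.Beta.FP.TowerDoorUniformDataTorus

end
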